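import Literature.NumberTheory.GaloisCohomology.Howard2004.DVRLevelTorsionControlProofs
import Literature.NumberTheory.GaloisCohomology.Howard2004.SelmerARepresentativeProofs
import HarnessLib

/-!
# Howard 2004, Lemma 1.3.3 in the colimit `H¹(K, A)` of a `DVRSetting`: `H¹_F(K, A)[𝔪^{e_k}] = im H¹_F(K, T^{(k)})`,
# and `condA F = F` (theorems only)

Topic `NumberTheory/GaloisCohomology/Howard2004` (sequel to `DVRLevelTorsionControlProofs` — Lemma 1.3.3 for the levels
`(k, k+1)` — and to `SelmerARepresentativeProofs` — representatives of `H¹_F(K, A) = selmerA`).  THEOREMS ONLY: no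
definition, no named fact, no instance, no notation, no `sorry`.

WHY (INPUTS row G87 = `Howard2004.thm161_dvrKolyvaginBound` = Howard Thm. 1.6.1; stub `stub_h161` of the μ-crux
stmt-BirchSwinnertonDyer-22642, binder `h161` of crux 23055's print-leaf census; cell `pub/bsd-print-x9`, seat
`bsd-line-x10b-p1-w2` g14).  The typed conclusion (ii) of Thm. 1.6.1 (`DVRSetting.Conclusion`: an `R`-equivariant
`Φ : H¹_F(K, A) ≃+ 𝒟 ⊕ (M ⊕ M)`) is about the tree's `selmerA = ⨆_j [H¹_{condA F j}(K, T^{(j)})] ⊆ H¹(K, A) = colim`; print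
reads it off «`H¹_F(K, A)[𝔪^k] ≅ H¹_F(K, T^{(k)}) ≅ R/𝔪^k ⊕ M^{(k)} ⊕ M^{(k)}`» (arXiv:1202.6340 p. 12 L40–44).  This file
supplies the first isomorphism, on a `DVRSetting` satisfying H.0–H.5:

* §1 `DVRSetting.incLocIter_mem_cond_iff`, **`condA_apply_eq`**, `condA_eq` — the saturated conditions `condA F j` ARE
  the conditions `F_j` (the cartesian identity of `DVRLevelTorsionControlProofs`, iterated), so `selmerA` is built from
  Howard's `H¹_F(K, T^{(j)})` themselves;
* §2 `incH1LE_injective`, **`of_injective`** (`[·]_j : H¹(K, T^{(j)}) ↪ H¹(K, A)`), `exists_mem_selmerGroup_incH1LE_eq`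
  (descent of a `π^{e_k}`-killed Selmer class from level `k + d` to level `k`);
* §3 **`DVRSetting.mem_selmerA_and_map_pow_eq_zero_iff`** —
  `(a ∈ H¹_F(K, A) ∧ π^{e_k} • a = 0) ↔ ∃ c ∈ H¹_F(K, T^{(k)}), [c]_k = a`.

Print: Howard, Compositio Math. 140 (2004) = arXiv:1202.6340, Lemma 1.3.3 (p. 7 L152–160) and the proof of Thm. 1.6.1
(p. 12 L40–48); Mazur–Rubin, Mem. AMS 799 (2004), Lemma 3.5.4.  HONEST FRAMING: `thm161_dvrKolyvaginBound` is NOT proved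
(the levelwise structure Thm. 1.4.2/Prop. 1.5.5, Lemma 1.6.4, the algebra of conclusion (ii) and the glue remain); no
summit statement is proved; the Birch–Swinnerton-Dyer conjecture is not proved by any of this.
References: [Howard2004HeegnerKolyvagin] Lemma 1.3.3, H.3, §1.6, Thm. 1.6.1; [MazurRubinMemoirs2004] Lemma 3.5.4;
[SerreGaloisCohomology1997] I §2.2.
-/

set_option autoImplicit false

noncomputable section

open Function NumberField IsDedekindDomain Field
open scoped NumberField ContRepresentation Pointwise

namespace Literature.NumberTheory.GaloisCohomology.Howard2004

open Literature.NumberTheory.GaloisRepresentations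
open Literature.NumberTheory.GaloisRepresentations.DiscreteGaloisModule

namespace DVRSetting

variable {p : ℕ} [Fact p.Prime] {K : Type} [Field K] [NumberField K]
  {R : Type} [CommRing R] [IsDomain R] [IsDiscreteValuationRing R] [Algebra ℤ_[p] R]
  {N : ℕ → Type} [∀ k, AddCommGroup (N k)] [∀ k, TopologicalSpace (N k)]
  [∀ k, DiscreteTopology (N k)] [∀ k, Module R (N k)]
  {Rk : ℕ → Type} [∀ k, CommRing (Rk k)] [∀ k, IsLocalRing (Rk k)] [∀ k, TopologicalSpace (Rk k)]
  [∀ k, DiscreteTopology (Rk k)] [∀ k, Algebra ℤ_[p] (Rk k)] [∀ k, Algebra R (Rk k)]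
  [∀ k, Module (Rk k) (N k)] [∀ k, IsScalarTower R (Rk k) (N k)]
  {Nbar : Type} [AddCommGroup Nbar] [TopologicalSpace Nbar] [DiscreteTopology Nbar]
  [∀ k, Module (Rk k) Nbar]
  {Nq : ℕ → Finset (HeightOneSpectrum (𝓞 K)) → Type} [∀ k n, AddCommGroup (Nq k n)]
  [∀ k n, TopologicalSpace (Nq k n)] [∀ k n, DiscreteTopology (Nq k n)]
  [∀ k n, Module (Rk k) (Nq k n)] [∀ k n, Module R (Nq k n)]
  [∀ k n, IsScalarTower R (Rk k) (Nq k n)]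

/-! ## §1 The propagated conditions `condA F` ARE the conditions `F` (iterated cartesian identity) -/

/-- **`incLocIter_j^d x ∈ F_{j+d,v} ↔ x ∈ F_{j,v}`** — the one-step cartesian identity `comap_incLoc_cond_eq`, iterated. [cite: Howard2004HeegnerKolyvagin, Lemma 1.3.3, H.3 and §1.6 (arXiv p. 7 L65–67 and L152–160, p. 11 L18–20, p. 12 L40–48)] -/
theorem incLocIter_mem_cond_iff (S : DVRSetting p K R N Rk Nbar Nq) (hy : S.SatisfiesH)
    (hπm : S.π ∈ IsLocalRing.maximalIdeal R) (hle : ∀ k, S.e k ≤ S.e (k + 1)) (j : ℕ) (v : Place K) :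
    ∀ (d : ℕ) (x : galoisCohomology ((S.T.ρ j).toLocal v) 1),
      AdicTower.incLocIter S.T S.π S.e hy.killed hy.ker_red hπm hle j v d x ∈ (S.t (j + d)).cond v ↔
        x ∈ (S.t j).cond v
  | 0, x => Iff.rfl
  | d + 1, x => by
    change AdicTower.incLoc S.T S.π S.e hy.killed hy.ker_red hπm hle (j + d) v
        (AdicTower.incLocIter S.T S.π S.e hy.killed hy.ker_red hπm hle j v d x) ∈ (S.t (j + d + 1)).cond v ↔ _
    rw [← AddSubgroup.mem_comap, S.comap_incLoc_cond_eq hy hπm hle (j + d) v]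
    exact S.incLocIter_mem_cond_iff hy hπm hle j v d x

/-- **`condA F j v = F_{j,v}`** on a `DVRSetting` with H.0–H.5: the pull-back-saturated local condition
`condA F j v = ⨆_d (incLocIter_j^d)⁻¹ F_{j+d,v}` through which the tree DEFINES `H¹_F(K, A) = selmerA` IS Howard's
propagated condition `F_{j,v}` (cartesian identity; «`F ⊗ Φ` pushed to `A`, then pulled back», arXiv p. 11 L18–20). [cite: Howard2004HeegnerKolyvagin, Lemma 1.3.3, H.3 and §1.6 (arXiv p. 7 L65–67 and L152–160, p. 11 L18–20, p. 12 L40–48)] -/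
theorem condA_apply_eq (S : DVRSetting p K R N Rk Nbar Nq) (hy : S.SatisfiesH)
    (hπm : S.π ∈ IsLocalRing.maximalIdeal R) (hle : ∀ k, S.e k ≤ S.e (k + 1)) (j : ℕ) (v : Place K) :
    AdicTower.condA S.T S.π S.e hy.killed hy.ker_red hπm hle (fun k => (S.t k).cond) j v = (S.t j).cond v := by
  ext x
  rw [AdicTower.mem_condA_iff S.T S.π S.e hy.killed hy.ker_red hπm hle (fun k => (S.t k).cond) hy.cond_red
    hy.cond_smul]
  constructor
  · rintro ⟨d, hd⟩
    exact (S.incLocIter_mem_cond_iff hy hπm hle j v d x).1 hd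
  · intro hx
    exact ⟨0, hx⟩

/-- **`condA F j = F_j`** as Selmer structures (so `H¹_F(K, A) = ⨆_j [H¹_{F_j}(K, T^{(j)})]`). [cite: Howard2004HeegnerKolyvagin, Lemma 1.3.3, H.3 and §1.6 (arXiv p. 7 L65–67 and L152–160, p. 11 L18–20, p. 12 L40–48)] -/
theorem condA_eq (S : DVRSetting p K R N Rk Nbar Nq) (hy : S.SatisfiesH)
    (hπm : S.π ∈ IsLocalRing.maximalIdeal R) (hle : ∀ k, S.e k ≤ S.e (k + 1)) (j : ℕ) :
    AdicTower.condA S.T S.π S.e hy.killed hy.ker_red hπm hle (fun k => (S.t k).cond) j = (S.t j).cond :=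
  funext fun v => S.condA_apply_eq hy hπm hle j v

/-! ## §2 `incH1LE` and `of` are injective; descent through several levels -/

/-- **`H¹(K, T^{(i)}) → H¹(K, T^{(j)})` (`i ≤ j`) is injective** (composite of the injective `H¹(K, inc_k)`,
`DVRSetting.incH1_injective`). [cite: Howard2004HeegnerKolyvagin, Lemma 1.3.3 and Thm. 1.6.1 proof (arXiv p. 7 L152–160, p. 12 L40–44)] [cite: MazurRubinMemoirs2004, Lemma 3.5.4] -/
theorem incH1LE_injective (S : DVRSetting p K R N Rk Nbar Nq) (hy : S.SatisfiesH)
    (hπm : S.π ∈ IsLocalRing.maximalIdeal R) (hle : ∀ k, S.e k ≤ S.e (k + 1)) (i : ℕ) :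
    ∀ (j : ℕ) (h : i ≤ j), Function.Injective (AdicTower.incH1LE S.T S.π S.e hy.killed hy.ker_red hπm hle i j h) := by
  intro j h
  induction h with
  | refl =>
    intro a b hab
    have h0 : AdicTower.incH1LE S.T S.π S.e hy.killed hy.ker_red hπm hle i i le_rfl = AddMonoidHom.id _ :=
      Nat.leRec_self _ _
    rwa [h0] at hab
  | @step j hij ih =>
    intro a b hab
    have h1 : AdicTower.incH1LE S.T S.π S.e hy.killed hy.ker_red hπm hle i (j + 1) (Nat.le.step hij) =
        (S.T.incH1 S.π S.e hy.killed hy.ker_red hπm hle j).comp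
          (AdicTower.incH1LE S.T S.π S.e hy.killed hy.ker_red hπm hle i j hij) :=
      Nat.leRec_succ _ _ hij
    rw [h1] at hab
    exact ih (S.incH1_injective hy hπm hle j hab)

/-- **`[·]_j : H¹(K, T^{(j)}) → H¹(K, A) = colim` is injective** (the transition maps are; `DirectLimit.of.zero_exact` on
the directed system `AdicTower.directedSystem_incH1LE`). [cite: Howard2004HeegnerKolyvagin, Lemma 1.3.3 and Thm. 1.6.1 proof (arXiv p. 7 L152–160, p. 12 L40–44)] [cite: MazurRubinMemoirs2004, Lemma 3.5.4] -/
theorem of_injective (S : DVRSetting p K R N Rk Nbar Nq) (hy : S.SatisfiesH)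
    (hπm : S.π ∈ IsLocalRing.maximalIdeal R) (hle : ∀ k, S.e k ≤ S.e (k + 1)) (j : ℕ) :
    Function.Injective (AddCommGroup.DirectLimit.of (fun k => galoisCohomology (S.T.ρ k) 1)
      (AdicTower.incH1LE S.T S.π S.e hy.killed hy.ker_red hπm hle) j) := by
  haveI := AdicTower.directedSystem_incH1LE S.T S.π S.e hy.killed hy.ker_red hπm hle
  refine (injective_iff_map_eq_zero _).2 fun c hc => ?_
  obtain ⟨l, hl, h0⟩ := AddCommGroup.DirectLimit.of.zero_exact _ _ hc
  exact S.incH1LE_injective hy hπm hle j l hl (by rw [h0, map_zero])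

/-- **Descent through `d` levels**: a Selmer class of `H¹_F(K, T^{(k+d)})` killed by `π^{e_k}` is `inc_{k→k+d} c₀` for a
Selmer class `c₀ ∈ H¹_F(K, T^{(k)})` (the one-step Lemma 1.3.3 `exists_mem_selmerGroup_incH1_eq_iff`, `e_k ≤ e_{k+d}`,
injectivity of `H¹(inc)`). [cite: Howard2004HeegnerKolyvagin, Lemma 1.3.3 and Thm. 1.6.1 proof (arXiv p. 7 L152–160, p. 12 L40–44)] [cite: MazurRubinMemoirs2004, Lemma 3.5.4] -/
theorem exists_mem_selmerGroup_incH1LE_eq (S : DVRSetting p K R N Rk Nbar Nq) (hy : S.SatisfiesH)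
    (hπm : S.π ∈ IsLocalRing.maximalIdeal R) (hle : ∀ k, S.e k ≤ S.e (k + 1)) (k : ℕ) :
    ∀ (d : ℕ) (c : galoisCohomology (S.T.ρ (k + d)) 1), c ∈ ((S.t (k + d)).cond).selmerGroup →
      galoisCohomology.scalarMapH1 (S.T.ρ (k + d)) (S.T.hlin (k + d)) (S.π ^ S.e k) c = 0 →
        ∃ c₀ ∈ ((S.t k).cond).selmerGroup,
          AdicTower.incH1LE S.T S.π S.e hy.killed hy.ker_red hπm hle k (k + d) (Nat.le_add_right k d) c₀ = c
  | 0, c, hc, _ => ⟨c, hc, by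
      have h0 : AdicTower.incH1LE S.T S.π S.e hy.killed hy.ker_red hπm hle k k le_rfl = AddMonoidHom.id _ :=
        Nat.leRec_self _ _
      exact (DFunLike.congr_fun h0 c).trans rfl⟩
  | d + 1, c, hc, h0 => by
    change c ∈ ((S.t (k + d + 1)).cond).selmerGroup at hc
    change galoisCohomology.scalarMapH1 (S.T.ρ (k + d + 1)) (S.T.hlin (k + d + 1)) (S.π ^ S.e k) c = 0 at h0
    change ∃ c₀ ∈ ((S.t k).cond).selmerGroup,
      AdicTower.incH1LE S.T S.π S.e hy.killed hy.ker_red hπm hle k (k + d + 1) (Nat.le_add_right k (d + 1)) c₀ = c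
    -- `π^{e_{k+d}} c = 0` since `e_k ≤ e_{k+d}`
    have hkd : S.e k ≤ S.e (k + d) := hy.e_strictMono.monotone (Nat.le_add_right k d)
    have h0' : galoisCohomology.scalarMapH1 (S.T.ρ (k + d + 1)) (S.T.hlin (k + d + 1)) (S.π ^ S.e (k + d)) c = 0 := by
      rw [← Nat.sub_add_cancel hkd, pow_add, galoisCohomology.scalarMapH1_mul, AddMonoidHom.comp_apply, h0,
        map_zero]
    obtain ⟨c₁, hc₁, rfl⟩ := (S.exists_mem_selmerGroup_incH1_eq_iff hy hπm hle (k + d) c).2 ⟨hc, h0'⟩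
    -- `π^{e_k} c₁ = 0` by injectivity of `H¹(inc_{k+d})`
    have h1 : galoisCohomology.scalarMapH1 (S.T.ρ (k + d)) (S.T.hlin (k + d)) (S.π ^ S.e k) c₁ = 0 := by
      apply S.incH1_injective hy hπm hle (k + d)
      rw [AdicTower.incH1_scalarMapH1, h0, map_zero]
    obtain ⟨c₀, hc₀, rfl⟩ := S.exists_mem_selmerGroup_incH1LE_eq hy hπm hle k d c₁ hc₁ h1
    refine ⟨c₀, hc₀, ?_⟩
    have h2 : AdicTower.incH1LE S.T S.π S.e hy.killed hy.ker_red hπm hle k (k + d + 1) (Nat.le_add_right k (d + 1)) =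
        (S.T.incH1 S.π S.e hy.killed hy.ker_red hπm hle (k + d)).comp
          (AdicTower.incH1LE S.T S.π S.e hy.killed hy.ker_red hπm hle k (k + d) (Nat.le_add_right k d)) :=
      Nat.leRec_succ _ _ (Nat.le_add_right k d)
    rw [h2, AddMonoidHom.comp_apply]

/-! ## §3 Lemma 1.3.3 in the colimit: `H¹_F(K, A)[𝔪^{e_k}] = im H¹_F(K, T^{(k)})` -/

/-- **Howard 2004, Lemma 1.3.3 read in `H¹(K, A) = colim_k H¹(K, T^{(k)})`** (arXiv p. 12 L40–44: «`H¹_F(K, A)[𝔪^k] ≅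
H¹_F(K, T^{(k)})`»): on a `DVRSetting` with H.0–H.5, a class `a ∈ H¹(K, A)` lies in `H¹_F(K, A)` AND is killed by `π^{e_k}`
(the scalar acting by `DirectLimit.map (H¹(π^{e_k}·))`, `SelmerAScalarStabilityProofs`) iff `a = [c]_k` for a Selmer class
`c ∈ H¹_F(K, T^{(k)})` — unique by `of_injective`; i.e. **`H¹_F(K, A)[𝔪^{e_k}]` is EXACTLY the (bijective) image of
`H¹_F(K, T^{(k)})`**.  This is the Galois-cohomological input «X_k» of conclusion (ii) of Thm. 1.6.1 (`H¹_F(K, A) ≅ 𝒟 ⊕ M ⊕ M`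
from the levelwise structure Thm. 1.4.2/Prop. 1.5.5 of the `H¹_F(K, T^{(k)})`); it does NOT prove `thm161_dvrKolyvaginBound`. [cite: Howard2004HeegnerKolyvagin, Lemma 1.3.3 and Thm. 1.6.1 proof (arXiv p. 7 L152–160, p. 12 L40–44)] [cite: MazurRubinMemoirs2004, Lemma 3.5.4] -/
theorem mem_selmerA_and_map_pow_eq_zero_iff (S : DVRSetting p K R N Rk Nbar Nq) (hy : S.SatisfiesH)
    (hπm : S.π ∈ IsLocalRing.maximalIdeal R) (hle : ∀ k, S.e k ≤ S.e (k + 1)) (k : ℕ)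
    (a : AdicTower.H1A S.T S.π S.e hy.killed hy.ker_red hπm hle) :
    (a ∈ S.T.selmerA S.π S.e hy.killed hy.ker_red hπm hle (fun k => (S.t k).cond) ∧
      (AddCommGroup.DirectLimit.map (fun j => galoisCohomology.scalarMapH1 (S.T.ρ j) (S.T.hlin j) (S.π ^ S.e k))
          (AdicTower.scalarMapH1_comp_incH1LE S.T S.π S.e hy.killed hy.ker_red hπm hle (S.π ^ S.e k)) a :
          AdicTower.H1A S.T S.π S.e hy.killed hy.ker_red hπm hle) = 0) ↔
      ∃ c ∈ ((S.t k).cond).selmerGroup,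
        AddCommGroup.DirectLimit.of (fun j => galoisCohomology (S.T.ρ j) 1)
          (AdicTower.incH1LE S.T S.π S.e hy.killed hy.ker_red hπm hle) k c = a := by
  haveI := AdicTower.directedSystem_incH1LE S.T S.π S.e hy.killed hy.ker_red hπm hle
  constructor
  · rintro ⟨ha, h0⟩
    obtain ⟨j, c, hc, rfl⟩ := (S.mem_selmerA_iff hy hπm hle a).1 ha
    rw [S.condA_eq hy hπm hle j] at hc
    rw [AdicTower.map_scalarMapH1_of] at h0
    obtain ⟨l, hjl, hl⟩ := AddCommGroup.DirectLimit.of.zero_exact _ _ h0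
    -- move to the level `k + l ≥ l ≥ j`
    have hjm : j ≤ k + l := hjl.trans (Nat.le_add_left l k)
    have hc' : AdicTower.incH1LE S.T S.π S.e hy.killed hy.ker_red hπm hle j (k + l) hjm c ∈
        ((S.t (k + l)).cond).selmerGroup := by
      have h := AdicTower.incH1LE_mem_selmerGroup_condA S.T S.π S.e hy.killed hy.ker_red hπm hle
        (fun k => (S.t k).cond) hy.cond_red hy.cond_smul j (k + l) hjm (by rw [S.condA_eq hy hπm hle j]; exact hc)
      rwa [S.condA_eq hy hπm hle (k + l)] at h
    have h0' : galoisCohomology.scalarMapH1 (S.T.ρ (k + l)) (S.T.hlin (k + l)) (S.π ^ S.e k)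
        (AdicTower.incH1LE S.T S.π S.e hy.killed hy.ker_red hπm hle j (k + l) hjm c) = 0 := by
      rw [← AddMonoidHom.comp_apply, AdicTower.scalarMapH1_comp_incH1LE, AddMonoidHom.comp_apply,
        ← AdicTower.incH1LE_incH1LE S.T S.π S.e hy.killed hy.ker_red hπm hle j l hjl (k + l) (Nat.le_add_left l k),
        hl, map_zero]
    obtain ⟨c₀, hc₀, h⟩ := S.exists_mem_selmerGroup_incH1LE_eq hy hπm hle k l _ hc' h0'
    refine ⟨c₀, hc₀, ?_⟩
    rw [← AddCommGroup.DirectLimit.of_f (G := fun j => galoisCohomology (S.T.ρ j) 1)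
        (f := AdicTower.incH1LE S.T S.π S.e hy.killed hy.ker_red hπm hle) (Nat.le_add_right k l) c₀, h,
      AddCommGroup.DirectLimit.of_f]
  · rintro ⟨c, hc, rfl⟩
    refine ⟨(S.mem_selmerA_iff hy hπm hle _).2 ⟨k, c, by rwa [S.condA_eq hy hπm hle k], rfl⟩, ?_⟩
    rw [AdicTower.map_scalarMapH1_of]
    have h0 : galoisCohomology.scalarMapH1 (S.T.ρ k) (S.T.hlin k) (S.π ^ S.e k) c = 0 :=
      galoisCohomology.smul_eq_zero_of_forall (S.T.ρ k) (S.T.hlin k) _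
        (fun m => hy.killed k _ (Ideal.pow_mem_pow hπm _) m) c
    rw [h0, map_zero]

end DVRSetting

end Literature.NumberTheory.GaloisCohomology.Howard2004

end
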